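import Literature.Geometry.Kaehler.ComplexTorusVerySimpleFixedPoints
import Literature.Geometry.Kaehler.ComplexTorusEndomorphismFieldPureMultiplicities
import Mathlib.RingTheory.SimpleModule.Basic
import Mathlib.LinearAlgebra.Eigenspace.Minpoly
import Mathlib.LinearAlgebra.Eigenspace.Charpoly
import Mathlib.RingTheory.RootsOfUnity.Complex
import HarnessLib

/-!
# The second alternative of Dolgachev–Zarhin's Theorem 2.18 forces `J ∈ ℝ[δ]`: `δ` has at most `(ℓ - 1)/2`
# distinct eigenvalues on `T₀X = Ω¹(X)^*` (Zarhin 2002, proof of Theorem 3.6, at torus level)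

Layer `Literature/Geometry/Kaehler`, namespace `Literature.Geometry.Kaehler.ComplexTorus` (§0, the double
centralizer theorem, in `Literature.LinearAlgebra.Matrix`); lane `lit-hodgefound` (Track 2 foundations
library), row g13-#3 of seat p11 (gen 13). Sequel of `ComplexTorusVerySimpleFixedPoints.lean` (g13-#1 FILE 2:
Theorem 2.18 at torus level — a very simple `A^δ` forces `End_δ(X) = ℤ[δ]` OR `End_δ(X) = End_{ℤ[δ]}(Λ)`
with `C(δ) := ` the commutant of `ℚ[δ]` in `End_ℚ(Λ ⊗ ℚ)` contained in `End⁰(X)`), of p12's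
`ComplexTorusEndomorphismFieldPureMultiplicities.lean` (`J ∈ ℝ[B] ⟺` no eigenvalue of `ρ_a(B)` occurs with
its complex conjugate, Moonen–Zarhin (2.4)) and of `ComplexTorusHodgeGroupCommutative.lean` §1/§4 (rational
descent; `J ∈ 𝔄 ⊗ ℝ ⟹ C(𝔄) ⊆ End⁰(X)`, Lange Prop. 7.2.5). THEOREMS ONLY (no definition, no named fact;
net debt 0).

## The print, verbatim

Yu. G. Zarhin, *Cyclic covers of the projective line, their jacobians and endomorphisms*, J. reine angew.
Math. **544** (2002) 91–110 (held text `paper:arxiv-math_0008134`), §3: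

* p0007 L52–L62: "**Theorem 3.6.** Assume that `p > 2` and `n ≥ 4`. Let `Λ_ℚ = Λ ⊗ ℚ` be the centralizer
  of `ℚ(δ_p)` in `End⁰(J^{(f,p)})`. Then `Λ_ℚ` could not be a central simple `ℚ(δ_p)`-algebra of dimension
  `(2g/(p-1))²` where `g` is genus of `C_{f,p}`. […] **Lemma 3.7.** Assume that `Λ_ℚ` is a central simple
  `ℚ(δ_p)`-algebra of dimension `(2g/(p-1))²`. Then there exist a `(p-1)/2`-dimensional abelian variety
  `Z` over `K_a`, a positive integer `r`, an embedding `ℚ(ζ_p) ≅ ℚ(δ_p) ↪ End⁰(Z)` and an isogeny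
  `φ : Z^r → J^{(f,p)}` […]."
* p0007 L88–L100 (proof of Theorem 3.6): "Clearly, `φ` induces an isomorphism
  `φ^* : Ω¹(J^{(f,p)}) ≅ Ω¹(Z^r) = Ω¹(Z)^r` which commutes with the natural actions of `ℚ(δ_p)`. Since
  `dim(Z) = (p-1)/2`, we have `dim_{K_a}(Ω¹(Z)) = (p-1)/2`. Therefore, the induced `K_a`-linear
  automorphism `δ_p^* : Ω¹(Z) → Ω¹(Z)` has, at most, `(p-1)/2` distinct eigenvalues. Clearly, the same is
  true for the action of `δ_p` in `Ω¹(Z)^r`. Since `φ` commutes with `δ_p`, the induced `K_a`-linear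
  automorphism `δ_p^* : Ω¹(J^{(f,p)}) → Ω¹(J^{(f,p)})` has, at most, `(p-1)/2` distinct eigenvalues."
  and p0008 L1–L12: "Therefore `δ_p` has in `Ω¹(C_{f,p})`, at least, `(p+1)/2` distinct eigenvalues.
  Contradiction."
* p0012 L17–L23: "**Theorem 5.2.** Let `p` be an odd prime and `ζ ∈ K`. If the `Gal(f)`-module
  `(𝔽_p^{𝔯_f})^{00}` is very simple then `ℚ(δ_p)` coincides with its own centralizer in `End⁰(J^{(f,p)})`
  […]."

I. Dolgachev, Yu. G. Zarhin, *Endomorphisms of Complex Abelian Varieties* (2024; `DolgachevZarhin2024`,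
held text `paper:galaxy-pdf-8712177384607648460`), §2.2 p0036: "**Theorem 2.18.** […] and enjoys one of
the following two properties. • `ℤ[δ] = End_δ(A)`. • `End_δ(A) = End_{ℤ[δ]}(Λ)` and `End_ℚ(A)_δ ≅
Mat_r(ℚ[δ])` […]".

N. Bourbaki, *Algèbre, Chapitre VIII* (2012), §5 n°4 (bicommutant d'un module semi-simple): a subalgebra
`B ⊆ End_F(V)` over which `V` is semisimple is its own bicommutant (Mathlib's `jacobson_density`, after
Lorenz, *Algebra II*, F20).

## What is formalised (the torus-level content), and the deviation

`X = E/Φ(ℤ^ι)` a complex torus of positive dimension with complex structure `J = jMatrix Φ ∈ M_ι(ℝ)`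
(`End⁰(X) = End_ℚ(X) = endAlgRat Φ = {A ∈ M_ι(ℚ) | A_ℝ J = J A_ℝ}`), `δ = D ∈ End(X) = endRingInt Φ` with
`Φ_ℓ(δ) = 0`, its analytic representation `ρ_a(δ) = analyticRep Φ Φ D_ℝ _ : T₀X →L[ℂ] T₀X` (`T₀X = E`, the
dual of `Ω¹(X)`: `δ^*` on `Ω¹(X)` and `ρ_a(δ)` have the same eigenvalues), `C(δ) = Subalgebra.centralizer ℚ
{D_ℚ}` the commutant of the field `ℚ[δ] ≅ ℚ(ζ_ℓ)` in `End_ℚ(Λ ⊗ ℚ) = M_ι(ℚ)`.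

Zarhin proves "`Λ_ℚ ≅ Mat(ℚ(ζ_p))` (= the second alternative of Theorem 2.18, i.e. `C(δ) ⊆ End⁰(X)`, FILE 2)
⟹ at most `(p-1)/2` distinct eigenvalues" THROUGH the isogeny `Z^r → J` of Lemma 3.7 and a dimension count
on `Ω¹(Z)`. At torus level we reach the same conclusion — and the sharper intermediate statement that the
complex structure is a real polynomial in `δ`, **`J ∈ ℝ[δ]`** (equivalently: the eigenvalues of `ρ_a(δ)`
form HALF of the primitive `ℓ`-th roots of unity, no two complex conjugate: a "CM type" of `ℚ(ζ_ℓ)` with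
multiplicities) — by linear algebra instead of the isogeny: `C(δ) ⊆ End⁰(X)` says that `J` commutes with
`C(δ) ⊗ ℝ`, so (rational descent, `ComplexTorusHodgeGroupCommutative` §1) `J ∈ C(C(δ)) ⊗ ℝ`, and
`C(C(δ)) = ℚ[δ]` by the double centralizer theorem for the field `ℚ[δ] ⊆ M_ι(ℚ)` (§0, from Mathlib's
Jacobson density theorem); then p12's `jMatrix_mem_adjoin_iff_forall_hasEigenvalue` (MZ98 (2.4)) turns
`J ∈ ℝ[δ]` into the eigenvalue statement, and counting inside the `ℓ - 1` primitive roots gives "at most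
(in fact exactly) `(ℓ-1)/2` distinct eigenvalues". The converse `J ∈ ℝ[δ] ⟹ C(δ) ⊆ End⁰(X)` is Lange's
Prop. 7.2.5 (tree). PACKAGED with FILE 2's `dolgachevZarhin_2_18`, Zarhin's contradiction ("at least
`(p+1)/2` distinct eigenvalues. Contradiction.") becomes: under the hypotheses of Theorem 2.18, an
eigenvalue `μ` of `ρ_a(δ)` whose conjugate `μ̄` is also an eigenvalue — in particular more than `(ℓ-1)/2`
distinct eigenvalues — forces the FIRST alternative `End_δ(X) = ℤ[δ]` (the abstract skeleton of Theorem 5.2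
/ of Dolgachev–Zarhin's application to superelliptic jacobians; the curve-theoretic input "the
differentials `dx/yⁱ`, `(p-1)/2 ≤ i ≤ p-1`, are eigenvectors with eigenvalues `ζ^{-i}`" is NOT formalised
here — it is a statement about `Ω¹(C_{f,p})`, not about the torus).

Results: §0 `centralizer_centralizer_eq_of_isSemisimpleModule`, `centralizer_centralizer_eq_of_isField`
(+ `_matrix`), `centralizer_centralizer_singleton_eq_adjoin`; §1 (any `A ∈ M_ι(ℚ)` with `ℚ[A]` a field)
`jMatrix_mem_adjoin_of_centralizer_le`, `centralizer_le_endAlgRat_of_jMatrix_mem_adjoin`,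
`centralizer_le_endAlgRat_iff_jMatrix_mem_adjoin`, `forall_hasEigenvalue_not_conj_of_centralizer_le`;
§2 (for `δ`) `aeval_analyticRep_cyclotomic_eq_zero`, `isPrimitiveRoot_of_hasEigenvalue`,
`hasEigenvalue_or_hasEigenvalue_conj` (`ζ` or `ζ̄` is an eigenvalue, for every primitive `ζ`),
`ncard_setOf_hasEigenvalue_le` (purity ⟹ `≤ φ(ℓ)/2` eigenvalues), `ncard_setOf_hasEigenvalue_eq` (`= φ(ℓ)/2`),
`jMatrix_mem_adjoin_of_centralizer_le_int`, `jMatrix_mem_adjoin_of_fixedImage_eq_top`,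
`forall_hasEigenvalue_not_conj_of_centralizer_le_int`, `ncard_setOf_hasEigenvalue_le_of_centralizer_le`
(Zarhin's "at most `(p-1)/2` distinct eigenvalues"), `hasEigenvalue_iff_not_hasEigenvalue_conj_of_centralizer_le`
(exactly one of `ζ`, `ζ̄`), `ncard_setOf_hasEigenvalue_eq_of_fixedImage_eq_top`, and the packaged
`coe_centralizerEnd_eq_adjoin_of_hasEigenvalue_conj`, `coe_centralizerEnd_eq_adjoin_of_lt_ncard_setOf_hasEigenvalue`.

## References

* [Zarhin2002CyclicCovers] Yu. G. Zarhin, *Cyclic covers of the projective line, their jacobians and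
  endomorphisms*, J. reine angew. Math. 544 (2002), §3 Thm. 3.6 (proof), Lemma 3.7, §5 Thm. 5.2 (held
  text p0007–p0008, p0012).
* [DolgachevZarhin2024] I. Dolgachev, Yu. G. Zarhin, *Endomorphisms of Complex Abelian Varieties* (2024),
  §2.2 Theorem 2.18 (held text p0036–p0037).
* [BourbakiAlgebreVIII2012] N. Bourbaki, *Algèbre, Chapitre VIII*, Springer 2012, §5 n°4.
* [MoonenZarhin1999LowDim] B. Moonen, Yu. Zarhin, *Hodge classes on abelian varieties of low dimension*,
  Math. Ann. 315 (1999), (2.2)–(2.4).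
* [Lange2023AbelianVarietiesComplex] H. Lange, *Abelian Varieties over the Complex Numbers* (2023), §1.1.2
  Prop. 1.1.6/1.1.9, §2.4.1 Prop. 2.4.3, §7.2.2 Prop. 7.2.5.
-/

noncomputable section

open Module Matrix Function Polynomial
open Literature.RepresentationTheory Literature.LinearAlgebra.Matrix

/-! ### §0 The double centralizer theorem for a semisimple module / a subfield of `End_F(V)` / of `M_n(F)` -/

namespace Literature.LinearAlgebra.Matrix

section Bicommutant

variable {F V : Type*} [Field F] [AddCommGroup V] [Module F V]

/-- **The double commutant theorem** (Bourbaki, Algèbre VIII §5 n°4 «bicommutant d'un module semi-simple»;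
von Neumann / Jacobson): a subalgebra `B ⊆ End_F V` over which the finite-dimensional `F`-space `V` is a
SEMISIMPLE module is its own bicommutant, `C(C(B)) = B`. Proof: an element `T` of the bicommutant commutes
with every `B`-linear endomorphism of `V` (each lies in `C(B)`), so it is linear over `End_B V`, and Mathlib's
Jacobson density theorem `jacobson_density` produces `r ∈ B` agreeing with `T` on a basis.
-- adapted from Summits/HodgeConjecture/HodgeConjecture/Theorems/Ring2HypothesesDescentAbsoluteBicommutant.lean §0 (not importable from Literature)
[cite: BourbakiAlgebreVIII2012, §5 n°4 (bicommutant d'un module semi-simple; théorème de densité)] -/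
theorem centralizer_centralizer_eq_of_isSemisimpleModule [FiniteDimensional F V]
    (B : Subalgebra F (Module.End F V)) [IsSemisimpleModule B V] :
    Subalgebra.centralizer F (Subalgebra.centralizer F (B : Set (Module.End F V)) : Set (Module.End F V)) =
      B := by
  classical
  refine le_antisymm (fun T hT ↦ ?_) fun x hx ↦ Set.subset_centralizer_centralizer hx
  rw [Subalgebra.mem_centralizer_iff] at hT
  -- (1) every `B`-linear endomorphism of `V`, read in `End_F V`, lies in `C(B)`, so commutes with `T`
  have hcomm : ∀ (g : Module.End B V) (v : V), T (g v) = g (T v) := by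
    intro g v
    have hg : (g.restrictScalars F : Module.End F V) ∈ Subalgebra.centralizer F (B : Set (Module.End F V)) := by
      rw [Subalgebra.mem_centralizer_iff]
      intro b hb
      refine LinearMap.ext fun w ↦ ?_
      change b (g w) = g (b w)
      exact (g.map_smul (⟨b, hb⟩ : B) w).symm
    exact (LinearMap.congr_fun (hT _ hg) v).symm
  -- (2) `T` is linear over the commutant `End_B V`
  let f : Module.End (Module.End B V) V :=
    { toFun := T
      map_add' := T.map_add
      map_smul' := fun g v ↦ hcomm g v }
  -- (3) Jacobson density on a basis
  let bV := Module.finBasis F V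
  obtain ⟨r, hr⟩ := jacobson_density f (Finset.univ.image bV)
  have hTr : T = (r : Module.End F V) :=
    bV.ext fun i ↦ hr (bV i) (Finset.mem_image_of_mem _ (Finset.mem_univ i))
  rw [hTr]
  exact r.2

/-- **The double centralizer theorem for a subfield `K ⊆ End_F(V)`** (`V` finite-dimensional): `C(C(K)) = K`
— `V` is a `K`-vector space, so a semisimple `K`-module. [cite: BourbakiAlgebreVIII2012, §5 n°4 (bicommutant d'un module semi-simple)] -/
theorem centralizer_centralizer_eq_of_isField [FiniteDimensional F V] (K : Subalgebra F (Module.End F V))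
    (hK : IsField K) :
    Subalgebra.centralizer F (Subalgebra.centralizer F (K : Set (Module.End F V)) : Set (Module.End F V)) =
      K := by
  letI : Field K := hK.toField
  haveI : IsSemisimpleModule K V := IsSemisimpleRing.isSemisimpleModule
  exact centralizer_centralizer_eq_of_isSemisimpleModule K

/-- Transport of commutants along an algebra isomorphism: `e(C(S)) = C(e(S))`. [folklore] -/
private theorem map_centralizer_algEquiv' {A B : Type*} [Semiring A] [Semiring B] [Algebra F A] [Algebra F B]
    (e : A ≃ₐ[F] B) (S : Set A) :
    (Subalgebra.centralizer F S).map (e : A →ₐ[F] B) = Subalgebra.centralizer F (e '' S) := by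
  apply le_antisymm
  · rintro _ ⟨x, hx, rfl⟩
    rw [Subalgebra.mem_centralizer_iff]
    rintro _ ⟨a, ha, rfl⟩
    change e a * e x = e x * e a
    rw [← map_mul, ← map_mul, (Subalgebra.mem_centralizer_iff F).1 hx a ha]
  · intro y hy
    rw [Subalgebra.mem_centralizer_iff] at hy
    refine Subalgebra.mem_map.2 ⟨e.symm y, ?_, e.apply_symm_apply y⟩
    rw [Subalgebra.mem_centralizer_iff]
    intro a ha
    apply e.injective
    rw [map_mul, map_mul, e.apply_symm_apply]
    exact hy (e a) ⟨a, ha, rfl⟩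

variable {ι : Type*} [Fintype ι] [DecidableEq ι]

/-- **The double centralizer theorem for a subfield `K ⊆ M_n(F)`**: `C(C(K)) = K` (transport of the
`End_F(F^n)` statement along `M_n(F) ≅ End_F(F^n)`). [cite: BourbakiAlgebreVIII2012, §5 n°4 (bicommutant d'un module semi-simple)] -/
theorem centralizer_centralizer_eq_of_isField_matrix (K : Subalgebra F (_root_.Matrix ι ι F)) (hK : IsField K) :
    Subalgebra.centralizer F (Subalgebra.centralizer F (K : Set (_root_.Matrix ι ι F)) : Set (_root_.Matrix ι ι F)) =
      K := by
  obtain ⟨e⟩ : Nonempty (_root_.Matrix ι ι F ≃ₐ[F] Module.End F (ι → F)) := ⟨Matrix.toLinAlgEquiv'⟩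
  set K' : Subalgebra F (Module.End F (ι → F)) := K.map (e : _root_.Matrix ι ι F →ₐ[F] Module.End F (ι → F))
    with hK'def
  have hK' : IsField K' :=
    MulEquiv.isField hK (K.equivMapOfInjective (e : _root_.Matrix ι ι F →ₐ[F] Module.End F (ι → F))
      e.injective).symm.toMulEquiv
  have h := centralizer_centralizer_eq_of_isField K' hK'
  have hmap₁ : (Subalgebra.centralizer F (K : Set (_root_.Matrix ι ι F))).map
      (e : _root_.Matrix ι ι F →ₐ[F] Module.End F (ι → F)) =
      Subalgebra.centralizer F (K' : Set (Module.End F (ι → F))) := by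
    rw [map_centralizer_algEquiv', hK'def, Subalgebra.coe_map]
    rfl
  have hmap₂ : (Subalgebra.centralizer F (Subalgebra.centralizer F (K : Set (_root_.Matrix ι ι F)) :
      Set (_root_.Matrix ι ι F))).map (e : _root_.Matrix ι ι F →ₐ[F] Module.End F (ι → F)) =
      Subalgebra.centralizer F (Subalgebra.centralizer F (K' : Set (Module.End F (ι → F))) :
        Set (Module.End F (ι → F))) := by
    rw [map_centralizer_algEquiv', ← hmap₁, Subalgebra.coe_map]
    rfl
  apply Subalgebra.map_injective (f := (e : _root_.Matrix ι ι F →ₐ[F] Module.End F (ι → F))) e.injective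
  rw [hmap₂, h]

/-- **The double centralizer theorem for one matrix generating a field**: if `F[T] ⊆ M_n(F)` is a field then
`C(C(T)) = F[T]` — the matrices commuting with the commutant of `T` are the polynomials in `T`.
[cite: BourbakiAlgebreVIII2012, §5 n°4 (bicommutant d'un module semi-simple)] -/
theorem centralizer_centralizer_singleton_eq_adjoin (T : _root_.Matrix ι ι F)
    (hK : IsField (Algebra.adjoin F ({T} : Set (_root_.Matrix ι ι F)))) :
    Subalgebra.centralizer F (Subalgebra.centralizer F ({T} : Set (_root_.Matrix ι ι F)) : Set (_root_.Matrix ι ι F)) =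
      Algebra.adjoin F ({T} : Set (_root_.Matrix ι ι F)) := by
  rw [centralizer_singleton_eq_centralizer_adjoin (F := F) T]
  exact centralizer_centralizer_eq_of_isField_matrix _ hK

end Bicommutant

end Literature.LinearAlgebra.Matrix

namespace Literature.Geometry.Kaehler

namespace ComplexTorus

open Literature.Geometry.Kaehler.CyclotomicIdempotents

variable {ι : Type*} [Fintype ι] [DecidableEq ι] {E : Type*} [NormedAddCommGroup E] [NormedSpace ℂ E]
  (Φ : (ι → ℝ) ≃L[ℝ] E)

/-! ### §1 `C(A) ⊆ End⁰(X) ⟺ J ∈ ℝ[A]` for a field `ℚ[A] ⊆ M_ι(ℚ)`; the eigenvalues of `ρ_a(A)` are then pure -/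

section Field

/-- `ℚ[A] ⊗ ℝ = ℝ[A]`: the real span of the realifications of `ℚ[A]` is (the underlying submodule of)
`ℝ[A_ℝ]`. [folklore] -/
private theorem span_image_adjoin_singleton (A : Matrix ι ι ℚ) :
    Submodule.span ℝ ((fun B : Matrix ι ι ℚ ↦ B.map (Rat.cast : ℚ → ℝ)) ''
        (Algebra.adjoin ℚ ({A} : Set (Matrix ι ι ℚ)) : Set (Matrix ι ι ℚ))) =
      Subalgebra.toSubmodule (Algebra.adjoin ℝ ({A.map (Rat.cast : ℚ → ℝ)} : Set (Matrix ι ι ℝ))) := by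
  classical
  -- realification as a `ℚ`-algebra homomorphism
  let φ : Matrix ι ι ℚ →ₐ[ℚ] Matrix ι ι ℝ := (Algebra.ofId ℚ ℝ).mapMatrix
  have hφ : ∀ B : Matrix ι ι ℚ, φ B = B.map (Rat.cast : ℚ → ℝ) := fun B ↦ by
    ext i j
    simp [φ]
  apply le_antisymm
  · rw [Submodule.span_le]
    rintro _ ⟨B, hB, rfl⟩
    rw [SetLike.mem_coe, Algebra.adjoin_singleton_eq_range_aeval] at hB
    obtain ⟨p, rfl⟩ := (AlgHom.mem_range _).1 hB
    change (aeval A p).map (Rat.cast : ℚ → ℝ) ∈ Subalgebra.toSubmodule _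
    rw [Subalgebra.mem_toSubmodule, ← hφ (aeval A p), ← aeval_algHom_apply, hφ, ← aeval_map_algebraMap ℝ]
    exact aeval_mem_adjoin_singleton ℝ _
  · intro x hx
    rw [Subalgebra.mem_toSubmodule, Algebra.adjoin_singleton_eq_range_aeval] at hx
    obtain ⟨q, rfl⟩ := (AlgHom.mem_range _).1 hx
    change aeval (A.map (Rat.cast : ℚ → ℝ)) q ∈ _
    rw [aeval_eq_sum_range]
    refine Submodule.sum_mem _ fun k _ ↦ Submodule.smul_mem _ _ (Submodule.subset_span ⟨A ^ k, ?_, ?_⟩)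
    · exact Subalgebra.pow_mem _ (Algebra.self_mem_adjoin_singleton ℚ A) k
    · change (A ^ k).map (Rat.cast : ℚ → ℝ) = (A.map (Rat.cast : ℚ → ℝ)) ^ k
      rw [← hφ, ← hφ, map_pow]

/-- **`C(A) ⊆ End⁰(X) ⟹ J ∈ ℝ[A]`** for `A ∈ M_ι(ℚ)` generating a FIELD `ℚ[A]`: if every rational matrix
commuting with `A` is an endomorphism of `X`, then the complex structure `J` is a real polynomial in `A`.
(`J` commutes with `C(A) ⊗ ℝ`, so by rational descent `J ∈ C(C(A)) ⊗ ℝ = ℚ[A] ⊗ ℝ = ℝ[A]`, §0.) The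
torus-level form of Zarhin's Lemma 3.7 ⟹ proof of Thm 3.6 ("`J^{(f,p)}` [is] of CM-type", the action of
`ℚ(δ_p)` on `Ω¹` has a CM type). [cite: Zarhin2002CyclicCovers, §3 Lemma 3.7 and proof of Thm 3.6 (p0007)] [cite: Lange2023AbelianVarietiesComplex, §7.2.2 Prop. 7.2.5 (proof)] -/
theorem jMatrix_mem_adjoin_of_centralizer_le {A : Matrix ι ι ℚ}
    (hA : IsField (Algebra.adjoin ℚ ({A} : Set (Matrix ι ι ℚ))))
    (hcen : Subalgebra.centralizer ℚ ({A} : Set (Matrix ι ι ℚ)) ≤ endAlgRat Φ) :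
    jMatrix Φ ∈ Algebra.adjoin ℝ ({A.map (Rat.cast : ℚ → ℝ)} : Set (Matrix ι ι ℝ)) := by
  have h := mem_span_map_ratCast_centralizer_of_forall_commute
    (Subalgebra.centralizer ℚ ({A} : Set (Matrix ι ι ℚ)) : Set (Matrix ι ι ℚ)) (M := jMatrix Φ)
    (fun B hB ↦ (mem_endAlgRat_iff Φ B).1 (hcen hB))
  rw [centralizer_centralizer_singleton_eq_adjoin A hA, span_image_adjoin_singleton] at h
  exact h

/-- **`J ∈ ℝ[A] ⟹ C(A) ⊆ End⁰(X)`** (no hypothesis on `A`): rational matrices commuting with `A` commute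
with `ℝ[A] ∋ J` (Lange, proof of Prop. 7.2.5). [cite: Lange2023AbelianVarietiesComplex, §7.2.2 Prop. 7.2.5 (proof)] -/
theorem centralizer_le_endAlgRat_of_jMatrix_mem_adjoin {A : Matrix ι ι ℚ}
    (hJ : jMatrix Φ ∈ Algebra.adjoin ℝ ({A.map (Rat.cast : ℚ → ℝ)} : Set (Matrix ι ι ℝ))) :
    Subalgebra.centralizer ℚ ({A} : Set (Matrix ι ι ℚ)) ≤ endAlgRat Φ := by
  rw [centralizer_singleton_eq_centralizer_adjoin (F := ℚ) A]
  refine centralizer_le_endAlgRat_of_jMatrix_mem_span Φ ?_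
  rw [span_image_adjoin_singleton]
  exact hJ

/-- **`C(A) ⊆ End⁰(X) ⟺ J ∈ ℝ[A]`** for a field `ℚ[A] ⊆ M_ι(ℚ)`. [cite: Zarhin2002CyclicCovers, §3 Lemma 3.7 and proof of Thm 3.6 (p0007)] [cite: Lange2023AbelianVarietiesComplex, §7.2.2 Prop. 7.2.5 (proof)] -/
theorem centralizer_le_endAlgRat_iff_jMatrix_mem_adjoin {A : Matrix ι ι ℚ}
    (hA : IsField (Algebra.adjoin ℚ ({A} : Set (Matrix ι ι ℚ)))) :
    Subalgebra.centralizer ℚ ({A} : Set (Matrix ι ι ℚ)) ≤ endAlgRat Φ ↔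
      jMatrix Φ ∈ Algebra.adjoin ℝ ({A.map (Rat.cast : ℚ → ℝ)} : Set (Matrix ι ι ℝ)) :=
  ⟨jMatrix_mem_adjoin_of_centralizer_le Φ hA, centralizer_le_endAlgRat_of_jMatrix_mem_adjoin Φ⟩

variable [FiniteDimensional ℂ E]

/-- **`C(A) ⊆ End⁰(X) ⟹` the eigenvalues of `ρ_a(A)` on `T₀X` are PURE**: no eigenvalue occurs together with
its complex conjugate (`J ∈ ℝ[A]` and Moonen–Zarhin (2.4), p12's `jMatrix_mem_adjoin_iff_forall_hasEigenvalue`).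
[cite: Zarhin2002CyclicCovers, §3 proof of Thm 3.6 (p0007)] [cite: MoonenZarhin1999LowDim, (2.2)–(2.4)] -/
theorem forall_hasEigenvalue_not_conj_of_centralizer_le {A : Matrix ι ι ℚ}
    (hA : IsField (Algebra.adjoin ℚ ({A} : Set (Matrix ι ι ℚ))))
    (hcen : Subalgebra.centralizer ℚ ({A} : Set (Matrix ι ι ℚ)) ≤ endAlgRat Φ)
    (hB : A.map (Rat.cast : ℚ → ℝ) * jMatrix Φ = jMatrix Φ * A.map (Rat.cast : ℚ → ℝ)) :
    ∀ μ : ℂ, Module.End.HasEigenvalue ((analyticRep Φ Φ (A.map (Rat.cast : ℚ → ℝ)) hB : E →L[ℂ] E) : E →ₗ[ℂ] E) μ →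
      ¬ Module.End.HasEigenvalue ((analyticRep Φ Φ (A.map (Rat.cast : ℚ → ℝ)) hB : E →L[ℂ] E) : E →ₗ[ℂ] E)
        (starRingEnd ℂ μ) :=
  (jMatrix_mem_adjoin_iff_forall_hasEigenvalue Φ hB).1 (jMatrix_mem_adjoin_of_centralizer_le Φ hA hcen)

/-- **`C(A) ⊆ End⁰(X) ⟺` pure eigenvalues**, for a field `ℚ[A] ⊆ M_ι(ℚ)` with `A ∈ End⁰(X) ⊗ ℝ`.
[cite: Zarhin2002CyclicCovers, §3 proof of Thm 3.6 (p0007)] [cite: MoonenZarhin1999LowDim, (2.2)–(2.4)] -/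
theorem centralizer_le_endAlgRat_iff_forall_hasEigenvalue {A : Matrix ι ι ℚ}
    (hA : IsField (Algebra.adjoin ℚ ({A} : Set (Matrix ι ι ℚ))))
    (hB : A.map (Rat.cast : ℚ → ℝ) * jMatrix Φ = jMatrix Φ * A.map (Rat.cast : ℚ → ℝ)) :
    Subalgebra.centralizer ℚ ({A} : Set (Matrix ι ι ℚ)) ≤ endAlgRat Φ ↔
      ∀ μ : ℂ, Module.End.HasEigenvalue ((analyticRep Φ Φ (A.map (Rat.cast : ℚ → ℝ)) hB : E →L[ℂ] E) : E →ₗ[ℂ] E) μ →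
        ¬ Module.End.HasEigenvalue ((analyticRep Φ Φ (A.map (Rat.cast : ℚ → ℝ)) hB : E →L[ℂ] E) : E →ₗ[ℂ] E)
          (starRingEnd ℂ μ) := by
  rw [centralizer_le_endAlgRat_iff_jMatrix_mem_adjoin Φ hA, jMatrix_mem_adjoin_iff_forall_hasEigenvalue Φ hB]

end Field

/-! ### §2 `δ ∈ End(X)`, `Φ_ℓ(δ) = 0`: eigenvalues of `ρ_a(δ)`; the second alternative ⟹ `J ∈ ℝ[δ]`, at
most `(ℓ-1)/2` distinct eigenvalues; the contrapositive packaged with Theorem 2.18 -/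

section Delta

variable {D : Matrix ι ι ℤ} {ℓ : ℕ}

omit [Fintype ι] [DecidableEq ι] in
/-- `(D_ℚ)_ℝ = D_ℝ`. [folklore] -/
private theorem map_intCast_map_ratCast' (D : Matrix ι ι ℤ) :
    (D.map (Int.cast : ℤ → ℚ)).map (Rat.cast : ℚ → ℝ) = D.map (Int.cast : ℤ → ℝ) := by
  ext i j
  simp

/-- **`Φ_ℓ(ρ_a(δ)) = 0`**: the analytic representation of `δ` satisfies the cyclotomic equation (`ρ_a` is a
ring homomorphism). [cite: DolgachevZarhin2024, §2.2 (before (2.15): "`Φ_ℓ(δ) = 0` in `End(A)`", chunk p0033)] [cite: Lange2023AbelianVarietiesComplex, §1.1.2 Prop. 1.1.6, Prop. 1.1.9] -/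
theorem aeval_analyticRep_cyclotomic_eq_zero (hD : aeval D (cyclotomic ℓ ℤ) = 0)
    (hB : D.map (Int.cast : ℤ → ℝ) * jMatrix Φ = jMatrix Φ * D.map (Int.cast : ℤ → ℝ)) :
    aeval ((analyticRep Φ Φ (D.map (Int.cast : ℤ → ℝ)) hB : E →L[ℂ] E) : E →ₗ[ℂ] E) (cyclotomic ℓ ℂ) = 0 := by
  -- on the real matrix
  have h1 : aeval (D.map (Int.cast : ℤ → ℝ)) (cyclotomic ℓ ℝ) = 0 := by
    have h := map_aeval_eq_aeval_map (S := Matrix ι ι ℤ) (U := Matrix ι ι ℝ) (φ := Int.castRingHom ℝ)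
      (ψ := (Int.castRingHom ℝ).mapMatrix) (RingHom.ext_int _ _) (cyclotomic ℓ ℤ) D
    rw [hD, map_zero, map_cyclotomic_int, RingHom.mapMatrix_apply, Int.coe_castRingHom] at h
    exact h.symm
  -- transported along `B ↦ Φ B Φ⁻¹`
  have h2 : aeval (analyticRepRealAlgEquiv Φ (D.map (Int.cast : ℤ → ℝ))) (cyclotomic ℓ ℝ) = 0 := by
    rw [aeval_algHom_apply, h1, map_zero]
  rw [analyticRepRealAlgEquiv_eq_restrictScalars Φ hB, aeval_algHom_apply] at h2
  have hinj : Function.Injective (endRestrictScalars ℝ ℂ E) := fun S T hST ↦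
    LinearMap.restrictScalars_injective ℝ hST
  have h3 : aeval ((analyticRep Φ Φ (D.map (Int.cast : ℤ → ℝ)) hB : E →L[ℂ] E) : E →ₗ[ℂ] E)
      (cyclotomic ℓ ℝ) = 0 := hinj (h2.trans (map_zero _).symm)
  rw [← map_cyclotomic ℓ (algebraMap ℝ ℂ), aeval_map_algebraMap]
  exact h3

/-- **The eigenvalues of `ρ_a(δ)` on `T₀X = Ω¹(X)^*` are primitive `ℓ`-th roots of unity** (`ℓ ≥ 1`).
[cite: Zarhin2002CyclicCovers, §3 proof of Thm 3.6 ("eigenvectors of `δ_p` with eigenvalues `ζ^{-i}`", p0008)] [cite: DolgachevZarhin2024, §2.2 (chunk p0033)] -/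
theorem isPrimitiveRoot_of_hasEigenvalue (hℓ : 0 < ℓ) (hD : aeval D (cyclotomic ℓ ℤ) = 0)
    (hB : D.map (Int.cast : ℤ → ℝ) * jMatrix Φ = jMatrix Φ * D.map (Int.cast : ℤ → ℝ)) {μ : ℂ}
    (hμ : Module.End.HasEigenvalue ((analyticRep Φ Φ (D.map (Int.cast : ℤ → ℝ)) hB : E →L[ℂ] E) : E →ₗ[ℂ] E) μ) :
    IsPrimitiveRoot μ ℓ := by
  haveI : NeZero ℓ := ⟨hℓ.ne'⟩
  have hmin := Module.End.isRoot_of_hasEigenvalue hμ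
  have hdvd : minpoly ℂ ((analyticRep Φ Φ (D.map (Int.cast : ℤ → ℝ)) hB : E →L[ℂ] E) : E →ₗ[ℂ] E) ∣
      cyclotomic ℓ ℂ := minpoly.dvd ℂ _ (aeval_analyticRep_cyclotomic_eq_zero Φ hD hB)
  exact isRoot_cyclotomic_iff.1 (hmin.dvd hdvd)

variable [FiniteDimensional ℂ E]

/-- **For every primitive `ℓ`-th root `ζ`, `ζ` or `ζ̄` is an eigenvalue of `ρ_a(δ)`** (positive dimension):
`P_δ = P^a · \overline{P^a}` (Lange Prop. 2.4.3 (a), the tree's `charpoly_map_eq_charpoly_analyticRep_mul_conj`)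
and `P_δ = Φ_ℓ^r`, `r = rk Λ/φ(ℓ) ≥ 1` — the torus-level form of "`dim Ω¹(Z) = (p-1)/2`", i.e. the
multiplicities of `ζ` and `ζ̄` add up to `r`. [cite: Zarhin2002CyclicCovers, §3 proof of Thm 3.6 (p0007)] [cite: Lange2023AbelianVarietiesComplex, §2.4.1 Prop. 2.4.3 (a)] -/
theorem hasEigenvalue_or_hasEigenvalue_conj [Nonempty ι] (hℓ : 0 < ℓ) (hD : aeval D (cyclotomic ℓ ℤ) = 0)
    (hB : D.map (Int.cast : ℤ → ℝ) * jMatrix Φ = jMatrix Φ * D.map (Int.cast : ℤ → ℝ)) {ζ : ℂ}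
    (hζ : IsPrimitiveRoot ζ ℓ) :
    Module.End.HasEigenvalue ((analyticRep Φ Φ (D.map (Int.cast : ℤ → ℝ)) hB : E →L[ℂ] E) : E →ₗ[ℂ] E) ζ ∨
      Module.End.HasEigenvalue ((analyticRep Φ Φ (D.map (Int.cast : ℤ → ℝ)) hB : E →L[ℂ] E) : E →ₗ[ℂ] E)
        (starRingEnd ℂ ζ) := by
  haveI : NeZero ℓ := ⟨hℓ.ne'⟩
  set P := ((analyticRep Φ Φ (D.map (Int.cast : ℤ → ℝ)) hB : E →L[ℂ] E) : E →ₗ[ℂ] E).charpoly with hP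
  have hDq : aeval (D.map (Int.cast : ℤ → ℚ)) (cyclotomic ℓ ℚ) = 0 := aeval_map_cyclotomic_eq_zero hD
  have hchq := charpoly_eq_cyclotomic_pow_of_aeval_eq_zero hℓ hDq
  set r := Fintype.card ι / Nat.totient ℓ with hr
  have hr0 : r ≠ 0 := by
    intro h0
    have hdeg := Matrix.charpoly_natDegree_eq_dim (D.map (Int.cast : ℤ → ℚ))
    rw [hchq, h0, pow_zero, natDegree_one] at hdeg
    exact Fintype.card_ne_zero hdeg.symm
  have hchR : (D.map (Int.cast : ℤ → ℝ)).charpoly = cyclotomic ℓ ℝ ^ r := by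
    rw [← map_intCast_map_ratCast' D, ← Rat.coe_castHom, Matrix.charpoly_map, hchq, Polynomial.map_pow,
      map_cyclotomic]
  have hfac := charpoly_map_eq_charpoly_analyticRep_mul_conj Φ hB
  rw [hchR, Polynomial.map_pow, map_cyclotomic, ← hP] at hfac
  have hζ0 : (cyclotomic ℓ ℂ ^ r).eval ζ = 0 := by
    rw [eval_pow, (isRoot_cyclotomic_iff.2 hζ).eq_zero, zero_pow hr0]
  rw [hfac, eval_mul, mul_eq_zero] at hζ0
  rcases hζ0 with h | h
  · exact Or.inl ((Module.End.hasEigenvalue_iff_isRoot_charpoly _ _).2 h)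
  · right
    rw [eval_map, ← Complex.conj_conj ζ, eval₂_at_apply, map_eq_zero] at h
    exact (Module.End.hasEigenvalue_iff_isRoot_charpoly _ _).2 h

omit [FiniteDimensional ℂ E] in
/-- **Pure eigenvalues ⟹ at most `φ(ℓ)/2` distinct eigenvalues**: if no eigenvalue of `ρ_a(δ)` occurs with
its conjugate then, the eigenvalues being primitive `ℓ`-th roots of unity, `ρ_a(δ)` has at most `φ(ℓ)/2`
(`= (ℓ-1)/2` for `ℓ` prime) distinct eigenvalues — the count "`δ_p^*` … has, at most, `(p-1)/2` distinct
eigenvalues". [cite: Zarhin2002CyclicCovers, §3 proof of Thm 3.6 (p0007 L88–L100)] -/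
theorem ncard_setOf_hasEigenvalue_le (hℓ : 0 < ℓ) (hD : aeval D (cyclotomic ℓ ℤ) = 0)
    (hB : D.map (Int.cast : ℤ → ℝ) * jMatrix Φ = jMatrix Φ * D.map (Int.cast : ℤ → ℝ))
    (hpure : ∀ μ : ℂ,
      Module.End.HasEigenvalue ((analyticRep Φ Φ (D.map (Int.cast : ℤ → ℝ)) hB : E →L[ℂ] E) : E →ₗ[ℂ] E) μ →
        ¬ Module.End.HasEigenvalue ((analyticRep Φ Φ (D.map (Int.cast : ℤ → ℝ)) hB : E →L[ℂ] E) : E →ₗ[ℂ] E)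
          (starRingEnd ℂ μ)) :
    {μ : ℂ | Module.End.HasEigenvalue
        ((analyticRep Φ Φ (D.map (Int.cast : ℤ → ℝ)) hB : E →L[ℂ] E) : E →ₗ[ℂ] E) μ}.ncard ≤ ℓ.totient / 2 := by
  classical
  set T := ((analyticRep Φ Φ (D.map (Int.cast : ℤ → ℝ)) hB : E →L[ℂ] E) : E →ₗ[ℂ] E) with hT
  set S : Finset ℂ := (primitiveRoots ℓ ℂ).filter (fun μ ↦ Module.End.HasEigenvalue T μ) with hS
  have hset : {μ : ℂ | Module.End.HasEigenvalue T μ} = ↑S := by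
    ext μ
    simp only [Set.mem_setOf_eq, hS, Finset.coe_filter, mem_primitiveRoots hℓ]
    exact ⟨fun h ↦ ⟨isPrimitiveRoot_of_hasEigenvalue Φ hℓ hD hB h, h⟩, fun h ↦ h.2⟩
  rw [hset, Set.ncard_coe_finset]
  -- `S` and `S̄` are disjoint subsets of the primitive roots
  have hinj : Function.Injective (starRingEnd ℂ) := RingHom.injective _
  have hcard : (S.image (starRingEnd ℂ)).card = S.card := Finset.card_image_of_injective _ hinj
  have hdisj : Disjoint S (S.image (starRingEnd ℂ)) := by
    rw [Finset.disjoint_left]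
    intro μ hμS hμT
    obtain ⟨ν, hνS, rfl⟩ := Finset.mem_image.1 hμT
    exact hpure ν (Finset.mem_filter.1 hνS).2 (Finset.mem_filter.1 hμS).2
  have hsub : S ∪ S.image (starRingEnd ℂ) ⊆ primitiveRoots ℓ ℂ := by
    intro μ hμ
    rcases Finset.mem_union.1 hμ with h | h
    · exact (Finset.mem_filter.1 h).1
    · obtain ⟨ν, hν, rfl⟩ := Finset.mem_image.1 h
      rw [mem_primitiveRoots hℓ]
      exact ((mem_primitiveRoots hℓ).1 (Finset.mem_filter.1 hν).1).map_of_injective hinj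
  have h := Finset.card_le_card hsub
  rw [Finset.card_union_of_disjoint hdisj, hcard, Complex.card_primitiveRoots] at h
  omega

/-- **Pure eigenvalues ⟹ exactly `φ(ℓ)/2` distinct eigenvalues** (positive dimension): with
`hasEigenvalue_or_hasEigenvalue_conj`, the eigenvalues are then exactly one out of each conjugate pair of
primitive `ℓ`-th roots of unity (a "CM type" of `ℚ(ζ_ℓ)`). [cite: Zarhin2002CyclicCovers, §3 proof of Thm 3.6 (p0007 L88–L100) and Lemma 3.7 ("`Z` and `J^{(f,p)}` are abelian varieties of CM-type")] -/
theorem ncard_setOf_hasEigenvalue_eq [Nonempty ι] (hℓ : 0 < ℓ) (hD : aeval D (cyclotomic ℓ ℤ) = 0)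
    (hB : D.map (Int.cast : ℤ → ℝ) * jMatrix Φ = jMatrix Φ * D.map (Int.cast : ℤ → ℝ))
    (hpure : ∀ μ : ℂ,
      Module.End.HasEigenvalue ((analyticRep Φ Φ (D.map (Int.cast : ℤ → ℝ)) hB : E →L[ℂ] E) : E →ₗ[ℂ] E) μ →
        ¬ Module.End.HasEigenvalue ((analyticRep Φ Φ (D.map (Int.cast : ℤ → ℝ)) hB : E →L[ℂ] E) : E →ₗ[ℂ] E)
          (starRingEnd ℂ μ)) :
    {μ : ℂ | Module.End.HasEigenvalue
        ((analyticRep Φ Φ (D.map (Int.cast : ℤ → ℝ)) hB : E →L[ℂ] E) : E →ₗ[ℂ] E) μ}.ncard = ℓ.totient / 2 := by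
  classical
  set T := ((analyticRep Φ Φ (D.map (Int.cast : ℤ → ℝ)) hB : E →L[ℂ] E) : E →ₗ[ℂ] E) with hT
  set S : Finset ℂ := (primitiveRoots ℓ ℂ).filter (fun μ ↦ Module.End.HasEigenvalue T μ) with hS
  have hset : {μ : ℂ | Module.End.HasEigenvalue T μ} = ↑S := by
    ext μ
    simp only [Set.mem_setOf_eq, hS, Finset.coe_filter, mem_primitiveRoots hℓ]
    exact ⟨fun h ↦ ⟨isPrimitiveRoot_of_hasEigenvalue Φ hℓ hD hB h, h⟩, fun h ↦ h.2⟩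
  rw [hset, Set.ncard_coe_finset]
  have hinj : Function.Injective (starRingEnd ℂ) := RingHom.injective _
  have hcard : (S.image (starRingEnd ℂ)).card = S.card := Finset.card_image_of_injective _ hinj
  have hdisj : Disjoint S (S.image (starRingEnd ℂ)) := by
    rw [Finset.disjoint_left]
    intro μ hμS hμT
    obtain ⟨ν, hνS, rfl⟩ := Finset.mem_image.1 hμT
    exact hpure ν (Finset.mem_filter.1 hνS).2 (Finset.mem_filter.1 hμS).2
  -- `S ∪ S̄` is all of the primitive roots
  have heq : S ∪ S.image (starRingEnd ℂ) = primitiveRoots ℓ ℂ := by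
    apply Finset.Subset.antisymm
    · intro μ hμ
      rcases Finset.mem_union.1 hμ with h | h
      · exact (Finset.mem_filter.1 h).1
      · obtain ⟨ν, hν, rfl⟩ := Finset.mem_image.1 h
        rw [mem_primitiveRoots hℓ]
        exact ((mem_primitiveRoots hℓ).1 (Finset.mem_filter.1 hν).1).map_of_injective hinj
    · intro ζ hζ
      have hζ' := (mem_primitiveRoots hℓ).1 hζ
      rcases hasEigenvalue_or_hasEigenvalue_conj Φ hℓ hD hB hζ' with h | h
      · exact Finset.mem_union_left _ (Finset.mem_filter.2 ⟨hζ, h⟩)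
      · refine Finset.mem_union_right _ (Finset.mem_image.2 ⟨starRingEnd ℂ ζ, ?_, Complex.conj_conj ζ⟩)
        refine Finset.mem_filter.2 ⟨?_, h⟩
        rw [mem_primitiveRoots hℓ]
        exact hζ'.map_of_injective hinj
  have h := congrArg Finset.card heq
  rw [Finset.card_union_of_disjoint hdisj, hcard, Complex.card_primitiveRoots] at h
  omega

omit [FiniteDimensional ℂ E] in
/-- **The second alternative of Theorem 2.18 ⟹ `J ∈ ℝ[δ]`**: if `C(δ) ⊆ End⁰(X)` then the complex structure
is a real polynomial in `δ` (positive dimension, `ℓ ≥ 1`). [cite: Zarhin2002CyclicCovers, §3 Lemma 3.7 and proof of Thm 3.6 (p0007)] [cite: DolgachevZarhin2024, §2.2 Thm 2.18 (second alternative, chunk p0036)] -/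
theorem jMatrix_mem_adjoin_of_centralizer_le_int [Nonempty ι] (hℓ : 0 < ℓ) (hD : aeval D (cyclotomic ℓ ℤ) = 0)
    (hcen : Subalgebra.centralizer ℚ ({D.map (Int.cast : ℤ → ℚ)} : Set (Matrix ι ι ℚ)) ≤ endAlgRat Φ) :
    jMatrix Φ ∈ Algebra.adjoin ℝ ({D.map (Int.cast : ℤ → ℝ)} : Set (Matrix ι ι ℝ)) := by
  have h := jMatrix_mem_adjoin_of_centralizer_le Φ
    (isField_adjoin_of_aeval_cyclotomic_eq_zero hℓ (aeval_map_cyclotomic_eq_zero hD)) hcen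
  rwa [map_intCast_map_ratCast'] at h

/-- **The second alternative ⟹ pure eigenvalues**: if `C(δ) ⊆ End⁰(X)` then no eigenvalue of `ρ_a(δ)` on
`T₀X` occurs together with its complex conjugate. [cite: Zarhin2002CyclicCovers, §3 proof of Thm 3.6 (p0007 L88–L100)] [cite: MoonenZarhin1999LowDim, (2.2)–(2.4)] -/
theorem forall_hasEigenvalue_not_conj_of_centralizer_le_int [Nonempty ι] (hℓ : 0 < ℓ)
    (hD : aeval D (cyclotomic ℓ ℤ) = 0)
    (hcen : Subalgebra.centralizer ℚ ({D.map (Int.cast : ℤ → ℚ)} : Set (Matrix ι ι ℚ)) ≤ endAlgRat Φ)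
    (hB : D.map (Int.cast : ℤ → ℝ) * jMatrix Φ = jMatrix Φ * D.map (Int.cast : ℤ → ℝ)) :
    ∀ μ : ℂ, Module.End.HasEigenvalue ((analyticRep Φ Φ (D.map (Int.cast : ℤ → ℝ)) hB : E →L[ℂ] E) : E →ₗ[ℂ] E) μ →
      ¬ Module.End.HasEigenvalue ((analyticRep Φ Φ (D.map (Int.cast : ℤ → ℝ)) hB : E →L[ℂ] E) : E →ₗ[ℂ] E)
        (starRingEnd ℂ μ) :=
  (jMatrix_mem_adjoin_iff_forall_hasEigenvalue Φ hB).1 (jMatrix_mem_adjoin_of_centralizer_le_int Φ hℓ hD hcen)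

/-- **Zarhin, proof of Theorem 3.6, at torus level: in the second alternative of Theorem 2.18, `ρ_a(δ)` has
at most `φ(ℓ)/2` distinct eigenvalues on `T₀X = Ω¹(X)^*`** ("`δ_p^* : Ω¹(J^{(f,p)}) → Ω¹(J^{(f,p)})` has, at
most, `(p-1)/2` distinct eigenvalues"); in fact exactly `φ(ℓ)/2` (`ncard_setOf_hasEigenvalue_eq`).
[cite: Zarhin2002CyclicCovers, §3 proof of Thm 3.6 (p0007 L88–L100)] -/
theorem ncard_setOf_hasEigenvalue_le_of_centralizer_le [Nonempty ι] (hℓ : 0 < ℓ)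
    (hD : aeval D (cyclotomic ℓ ℤ) = 0)
    (hcen : Subalgebra.centralizer ℚ ({D.map (Int.cast : ℤ → ℚ)} : Set (Matrix ι ι ℚ)) ≤ endAlgRat Φ)
    (hB : D.map (Int.cast : ℤ → ℝ) * jMatrix Φ = jMatrix Φ * D.map (Int.cast : ℤ → ℝ)) :
    {μ : ℂ | Module.End.HasEigenvalue
        ((analyticRep Φ Φ (D.map (Int.cast : ℤ → ℝ)) hB : E →L[ℂ] E) : E →ₗ[ℂ] E) μ}.ncard ≤ ℓ.totient / 2 ∧
      {μ : ℂ | Module.End.HasEigenvalue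
        ((analyticRep Φ Φ (D.map (Int.cast : ℤ → ℝ)) hB : E →L[ℂ] E) : E →ₗ[ℂ] E) μ}.ncard = ℓ.totient / 2 :=
  ⟨ncard_setOf_hasEigenvalue_le Φ hℓ hD hB (forall_hasEigenvalue_not_conj_of_centralizer_le_int Φ hℓ hD hcen hB),
    ncard_setOf_hasEigenvalue_eq Φ hℓ hD hB (forall_hasEigenvalue_not_conj_of_centralizer_le_int Φ hℓ hD hcen hB)⟩

/-- **In the second alternative, exactly one of `ζ`, `ζ̄` is an eigenvalue of `ρ_a(δ)`** for every primitive
`ℓ`-th root of unity `ζ` (the eigenvalues form a CM type of `ℚ(ζ_ℓ)`, each conjugate pair split).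
[cite: Zarhin2002CyclicCovers, §3 Lemma 3.7 ("`Z` and `J^{(f,p)}` are abelian varieties of CM-type") and proof of Thm 3.6 (p0007)] -/
theorem hasEigenvalue_iff_not_hasEigenvalue_conj_of_centralizer_le [Nonempty ι] (hℓ : 0 < ℓ)
    (hD : aeval D (cyclotomic ℓ ℤ) = 0)
    (hcen : Subalgebra.centralizer ℚ ({D.map (Int.cast : ℤ → ℚ)} : Set (Matrix ι ι ℚ)) ≤ endAlgRat Φ)
    (hB : D.map (Int.cast : ℤ → ℝ) * jMatrix Φ = jMatrix Φ * D.map (Int.cast : ℤ → ℝ)) {ζ : ℂ}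
    (hζ : IsPrimitiveRoot ζ ℓ) :
    Module.End.HasEigenvalue ((analyticRep Φ Φ (D.map (Int.cast : ℤ → ℝ)) hB : E →L[ℂ] E) : E →ₗ[ℂ] E) ζ ↔
      ¬ Module.End.HasEigenvalue ((analyticRep Φ Φ (D.map (Int.cast : ℤ → ℝ)) hB : E →L[ℂ] E) : E →ₗ[ℂ] E)
        (starRingEnd ℂ ζ) := by
  refine ⟨forall_hasEigenvalue_not_conj_of_centralizer_le_int Φ hℓ hD hcen hB ζ, fun h ↦ ?_⟩
  rcases hasEigenvalue_or_hasEigenvalue_conj Φ hℓ hD hB hζ with h' | h'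
  · exact h'
  · exact absurd h' h

variable [Module (ZMod ℓ) (fixedSubgroup Φ D)]

omit [FiniteDimensional ℂ E] in
/-- **`R = End_{𝔽_ℓ}(A^δ)` ⟹ `J ∈ ℝ[δ]`** (FILE 2's second case `centralizer_le_endAlgRat_of_fixedImage_eq_top`,
then `jMatrix_mem_adjoin_of_centralizer_le_int`). [cite: DolgachevZarhin2024, §2.2 Thm 2.18 (second alternative) and proof, case `d = r²` (chunks p0036–p0037)] [cite: Zarhin2002CyclicCovers, §3 Lemma 3.7 (p0007)] -/
theorem jMatrix_mem_adjoin_of_fixedImage_eq_top [Nonempty ι] (hℓ : ℓ.Prime) (hD : aeval D (cyclotomic ℓ ℤ) = 0)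
    (hDe : D ∈ endRingInt Φ) (htop : fixedImage Φ D ℓ = ⊤) :
    jMatrix Φ ∈ Algebra.adjoin ℝ ({D.map (Int.cast : ℤ → ℝ)} : Set (Matrix ι ι ℝ)) :=
  jMatrix_mem_adjoin_of_centralizer_le_int Φ hℓ.pos hD
    (centralizer_le_endAlgRat_of_fixedImage_eq_top Φ hℓ hD hDe htop)

/-- **`R = End_{𝔽_ℓ}(A^δ)` ⟹ `ρ_a(δ)` has exactly `(ℓ - 1)/2` distinct eigenvalues on `T₀X = Ω¹(X)^*`, no
two of them complex conjugate** (`ℓ` prime, positive dimension). [cite: Zarhin2002CyclicCovers, §3 proof of Thm 3.6 ("has, at most, `(p-1)/2` distinct eigenvalues", p0007 L88–L100)] [cite: DolgachevZarhin2024, §2.2 Thm 2.18 (second alternative, chunk p0036)] -/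
theorem ncard_setOf_hasEigenvalue_eq_of_fixedImage_eq_top [Nonempty ι] (hℓ : ℓ.Prime)
    (hD : aeval D (cyclotomic ℓ ℤ) = 0) (hDe : D ∈ endRingInt Φ) (htop : fixedImage Φ D ℓ = ⊤)
    (hB : D.map (Int.cast : ℤ → ℝ) * jMatrix Φ = jMatrix Φ * D.map (Int.cast : ℤ → ℝ)) :
    (∀ μ : ℂ, Module.End.HasEigenvalue ((analyticRep Φ Φ (D.map (Int.cast : ℤ → ℝ)) hB : E →L[ℂ] E) : E →ₗ[ℂ] E) μ →
      ¬ Module.End.HasEigenvalue ((analyticRep Φ Φ (D.map (Int.cast : ℤ → ℝ)) hB : E →L[ℂ] E) : E →ₗ[ℂ] E)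
        (starRingEnd ℂ μ)) ∧
      {μ : ℂ | Module.End.HasEigenvalue
        ((analyticRep Φ Φ (D.map (Int.cast : ℤ → ℝ)) hB : E →L[ℂ] E) : E →ₗ[ℂ] E) μ}.ncard = (ℓ - 1) / 2 := by
  have hcen := centralizer_le_endAlgRat_of_fixedImage_eq_top Φ hℓ hD hDe htop
  refine ⟨forall_hasEigenvalue_not_conj_of_centralizer_le_int Φ hℓ.pos hD hcen hB, ?_⟩
  rw [← Nat.totient_prime hℓ]
  exact (ncard_setOf_hasEigenvalue_le_of_centralizer_le Φ hℓ.pos hD hcen hB).2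

/-- **Theorem 2.18 + Zarhin's eigenvalue obstruction, at torus level** ("at least `(p+1)/2` distinct
eigenvalues. Contradiction."): under the hypotheses of Theorem 2.18 (`R` normal for `G`, the `G`-module
`A^δ` very simple), if some eigenvalue `μ` of `ρ_a(δ)` on `T₀X = Ω¹(X)^*` has its complex conjugate `μ̄`
among the eigenvalues, then the second alternative is excluded and **`End_δ(X) = ℤ[δ]`** — the skeleton of
Theorem 5.2 ("If the `Gal(f)`-module `(𝔽_p^{𝔯_f})^{00}` is very simple then `ℚ(δ_p)` coincides with its
own centralizer in `End⁰(J^{(f,p)})`"), whose curve-theoretic input (the eigenvalues `ζ^{-i}`,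
`(p-1)/2 ≤ i ≤ p-1`, of `δ_p` on `Ω¹(C_{f,p})`) is not a statement about the torus.
[cite: Zarhin2002CyclicCovers, §3 Thm 3.6 (proof, p0007–p0008) and §5 Thm 5.2 (p0012)] [cite: DolgachevZarhin2024, §2.2 Thm 2.18 (chunk p0036)] -/
theorem coe_centralizerEnd_eq_adjoin_of_hasEigenvalue_conj [Nonempty ι] (hℓ : ℓ.Prime)
    (hD : aeval D (cyclotomic ℓ ℤ) = 0) (hDe : D ∈ endRingInt Φ) {G : Type*} [Group G]
    {ρ : Representation (ZMod ℓ) G (fixedSubgroup Φ D)} (hnorm : IsNormalSubalgebra ρ (fixedImage Φ D ℓ))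
    (hvs : IsVerySimple ρ)
    (hB : D.map (Int.cast : ℤ → ℝ) * jMatrix Φ = jMatrix Φ * D.map (Int.cast : ℤ → ℝ)) {μ : ℂ}
    (h₁ : Module.End.HasEigenvalue ((analyticRep Φ Φ (D.map (Int.cast : ℤ → ℝ)) hB : E →L[ℂ] E) : E →ₗ[ℂ] E) μ)
    (h₂ : Module.End.HasEigenvalue ((analyticRep Φ Φ (D.map (Int.cast : ℤ → ℝ)) hB : E →L[ℂ] E) : E →ₗ[ℂ] E)
      (starRingEnd ℂ μ)) :
    (centralizerEnd Φ D : Set (Matrix ι ι ℤ)) = Algebra.adjoin ℤ ({D} : Set (Matrix ι ι ℤ)) := by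
  rcases dolgachevZarhin_2_18 Φ hℓ hD hDe hnorm hvs with h | ⟨_, hcen, _⟩
  · exact h
  · exact absurd h₂ (forall_hasEigenvalue_not_conj_of_centralizer_le_int Φ hℓ.pos hD hcen hB μ h₁)

/-- **Theorem 2.18 + Zarhin's count, at torus level**: under the hypotheses of Theorem 2.18, if `ρ_a(δ)` has
MORE than `(ℓ-1)/2` distinct eigenvalues on `T₀X = Ω¹(X)^*`, then `End_δ(X) = ℤ[δ]`.
[cite: Zarhin2002CyclicCovers, §3 Thm 3.6 (proof: "at most `(p-1)/2`" vs "at least `(p+1)/2` distinct eigenvalues. Contradiction.", p0007–p0008) and §5 Thm 5.2 (p0012)] [cite: DolgachevZarhin2024, §2.2 Thm 2.18 (chunk p0036)] -/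
theorem coe_centralizerEnd_eq_adjoin_of_lt_ncard_setOf_hasEigenvalue [Nonempty ι] (hℓ : ℓ.Prime)
    (hD : aeval D (cyclotomic ℓ ℤ) = 0) (hDe : D ∈ endRingInt Φ) {G : Type*} [Group G]
    {ρ : Representation (ZMod ℓ) G (fixedSubgroup Φ D)} (hnorm : IsNormalSubalgebra ρ (fixedImage Φ D ℓ))
    (hvs : IsVerySimple ρ)
    (hB : D.map (Int.cast : ℤ → ℝ) * jMatrix Φ = jMatrix Φ * D.map (Int.cast : ℤ → ℝ))
    (hlt : (ℓ - 1) / 2 < {μ : ℂ | Module.End.HasEigenvalue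
        ((analyticRep Φ Φ (D.map (Int.cast : ℤ → ℝ)) hB : E →L[ℂ] E) : E →ₗ[ℂ] E) μ}.ncard) :
    (centralizerEnd Φ D : Set (Matrix ι ι ℤ)) = Algebra.adjoin ℤ ({D} : Set (Matrix ι ι ℤ)) := by
  rcases dolgachevZarhin_2_18 Φ hℓ hD hDe hnorm hvs with h | ⟨_, hcen, _⟩
  · exact h
  · have hle := (ncard_setOf_hasEigenvalue_le_of_centralizer_le Φ hℓ.pos hD hcen hB).1
    rw [Nat.totient_prime hℓ] at hle
    exact absurd hlt (not_lt.2 hle)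

end Delta

end ComplexTorus

end Literature.Geometry.Kaehler

end
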